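import Summits.FinalStateConjecture.FinalStateConjecture.Theorems.SwallowTheDatumKerrShieldedDataExistCapMap
import Literature.Geometry.Lorentzian.KerrStarChartBounds
import Literature.Geometry.Lorentzian.KerrSchildCoord
import HarnessLib

/-!
# `KerrShieldedDataExist`, line `plug-the-second-sheet` (skeleton v4 "KerrCap") — stub `stub_capShield`, I:
# the end chart `φ(x⃗) = ϱ⁻¹(r) · Rot_z(−α(ϱ⁻¹ r)) ℓ⃗(x⃗)`, inverse of the cap map on the graph zone

Support file (`--supports stmt-FinalStateConjecture-10055`; everything proved, no definitions, no named facts)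
for the registered stub `stub_capShield` of `Cruxes/KerrShieldedDataExist/Lines/plug_the_second_sheet.lean`.
The spatial cap map is `X u = L_{ϱ(s)} Rot_z(α(s)) (u/s)`, `s = ‖u‖`, `L_r n = r n + a ẑ × n` (`…CapMap`); its
inverse on the graph zone is the END CHART of the crux's shielding block,
`φ(x⃗) = ϱ⁻¹(r) · Rot_z(−α(ϱ⁻¹ r)) ℓ⃗(x⃗)`, `r = r(0, x⃗)` the Kerr–Schild radius and
`ℓ⃗ = ((r x + a y)/(r² + a²), (r y − a x)/(r² + a²), z/r)` the spatial Kerr–Schild null vector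
(`Kerr.nullSpatial`, a unit vector with `L_r ℓ⃗(x⃗) = x⃗`). Both maps are arbitrary functions satisfying their
defining equations (hypotheses-with-equations `hX`, `hφ`, exactly as in the stub; no definition is introduced),
and `ϱinv` is any function with `ϱ (ϱinv r) = r`, `ϱinv (ϱ s) = s` at the relevant arguments. Contents:

* `nullSpatial_slice_apply`, `norm_rotNullSpatial`, `norm_capChart`: the components of `ℓ⃗`, and
  `‖φ x⃗‖ = ϱ⁻¹(r)` (`‖ℓ⃗‖ = 1`, rotations are isometries);
* `capMap_capChart`: **`X (φ x⃗) = x⃗`** (`Rot_z(α) Rot_z(−α) = 1`, `L_r ℓ⃗ = x⃗`);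
* `nullSpatial_capMap`, `capChart_capMap`: `ℓ⃗(X u) = Rot_z(α(s)) (u/s)` (`ℓ⃗(L_r n) = n` for unit `n`,
  radius identity `r(X u) = ϱ(s)` of `…CapMap`), hence **`φ (X u) = u`**;
* `contDiffAt_capChart`: `φ` is `C^∞` at every point with `r > 0` where `ϱinv` is `C^∞` at `r`;
* `capChart_topology`: for profiles with `ϱinv ∘ ϱ = id` on `{s > σ₄}`, `ϱ ∘ ϱinv = id` on `{r > r_b}`
  (exchanging the two half-lines), the end chart restricted to the Kerr–Schild slice `{r > r_b}` has range
  `{‖u‖ > σ₄}` (compact complement `closedBall 0 σ₄`), is an open embedding (a homeomorphism onto the open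
  set `{‖u‖ > σ₄}` with inverse `X`) and is `C^∞` as a map of manifolds `Kerr.slice a r_b → E3`.

References: Visser arXiv:0706.0622, §4 and (34)–(35) (Kerr's spheroidal coordinates, `ℓ⃗ = n̂`);
Dafermos–Rodnianski arXiv:0811.0354, §5.1; O'Neill 1983, Ch. 1 (open submanifolds, diffeomorphisms onto
open sets).
-/

-- the doubled `FinalStateConjecture` path component is the summit/problem naming scheme, not a mistake
set_option linter.dupNamespace false

noncomputable section

open Set Function Filter Topology TopologicalSpace
open scoped Manifold ContDiff Topology InnerProductSpace
open Literature.Geometry.Lorentzian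

namespace Summit.FinalStateConjecture.FinalStateConjecture.Theorems.SwallowTheDatum

namespace KerrCap

/-! ### The spatial null vector on the slice -/

/-- **Components of `ℓ⃗(0, y)`**: `((r y₀ + a y₁)/(r² + a²), (r y₁ − a y₀)/(r² + a²), y₂/r)` with
`r = r(0, y)`. Visser arXiv:0706.0622, (34). [cite: arXiv07060622, (34)] -/
theorem nullSpatial_slice_apply (a : ℝ) (y : E3) :
    Kerr.nullSpatial a (E4.ofTimeSpace 0 y) 0 =
        (Kerr.radius a (E4.ofTimeSpace 0 y) * y 0 + a * y 1) / (Kerr.radius a (E4.ofTimeSpace 0 y) ^ 2 + a ^ 2) ∧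
      Kerr.nullSpatial a (E4.ofTimeSpace 0 y) 1 =
        (Kerr.radius a (E4.ofTimeSpace 0 y) * y 1 - a * y 0) / (Kerr.radius a (E4.ofTimeSpace 0 y) ^ 2 + a ^ 2) ∧
      Kerr.nullSpatial a (E4.ofTimeSpace 0 y) 2 = y 2 / Kerr.radius a (E4.ofTimeSpace 0 y) := by
  refine ⟨?_, ?_, ?_⟩
  · rw [Kerr.nullSpatial_apply, Fin.succ_zero_eq_one, Kerr.nullCovectorFun_apply_one,
      Kerr.ofTimeSpace_apply_one_eq, Kerr.ofTimeSpace_apply_two_eq]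
  · rw [Kerr.nullSpatial_apply, Fin.succ_one_eq_two, Kerr.nullCovectorFun_apply_two,
      Kerr.ofTimeSpace_apply_one_eq, Kerr.ofTimeSpace_apply_two_eq]
  · rw [Kerr.nullSpatial_apply, Kerr.fin_succ_two_eq_three, Kerr.nullCovectorFun_ofTimeSpace_three]

/-- **`L_r ℓ⃗(x⃗) = x⃗`**: `r ℓ₀ − a ℓ₁ = y₀`, `r ℓ₁ + a ℓ₀ = y₁`, `r ℓ₂ = y₂` (`r > 0`) — the spatial null vector
is the spheroidal radial direction through `x⃗`. Visser arXiv:0706.0622, §4. [cite: arXiv07060622, §4] -/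
theorem spheroidal_nullSpatial {a : ℝ} {y : E3} (hr : 0 < Kerr.radius a (E4.ofTimeSpace 0 y)) :
    Kerr.radius a (E4.ofTimeSpace 0 y) * Kerr.nullSpatial a (E4.ofTimeSpace 0 y) 0 -
          a * Kerr.nullSpatial a (E4.ofTimeSpace 0 y) 1 = y 0 ∧
      Kerr.radius a (E4.ofTimeSpace 0 y) * Kerr.nullSpatial a (E4.ofTimeSpace 0 y) 1 +
          a * Kerr.nullSpatial a (E4.ofTimeSpace 0 y) 0 = y 1 ∧
      Kerr.radius a (E4.ofTimeSpace 0 y) * Kerr.nullSpatial a (E4.ofTimeSpace 0 y) 2 = y 2 := by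
  obtain ⟨h0, h1, h2⟩ := nullSpatial_slice_apply a y
  have hra : Kerr.radius a (E4.ofTimeSpace 0 y) ^ 2 + a ^ 2 ≠ 0 := by positivity
  refine ⟨?_, ?_, ?_⟩
  · rw [h0, h1]; field_simp; ring
  · rw [h0, h1]; field_simp; ring
  · rw [h2]; field_simp

/-- **Rotations about `ẑ` preserve the unit vector `ℓ⃗`**: `‖Rot_z(−β) ℓ⃗(0, y)‖ = 1` wherever `r > 0`
(`‖ℓ⃗‖ = 1`, `Kerr.norm_nullSpatial_slice`). [folklore] -/
theorem norm_rotNullSpatial {a : ℝ} {y : E3} (hr : 0 < Kerr.radius a (E4.ofTimeSpace 0 y)) (β : ℝ) :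
    ‖(!₂[Real.cos β * Kerr.nullSpatial a (E4.ofTimeSpace 0 y) 0 + Real.sin β * Kerr.nullSpatial a (E4.ofTimeSpace 0 y) 1,
        -(Real.sin β * Kerr.nullSpatial a (E4.ofTimeSpace 0 y) 0) +
          Real.cos β * Kerr.nullSpatial a (E4.ofTimeSpace 0 y) 1,
        Kerr.nullSpatial a (E4.ofTimeSpace 0 y) 2] : E3)‖ = 1 := by
  have h1 := Kerr.norm_nullSpatial_slice hr
  have hcs := Real.sin_sq_add_cos_sq β
  have hsq : ‖(!₂[Real.cos β * Kerr.nullSpatial a (E4.ofTimeSpace 0 y) 0 +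
        Real.sin β * Kerr.nullSpatial a (E4.ofTimeSpace 0 y) 1,
        -(Real.sin β * Kerr.nullSpatial a (E4.ofTimeSpace 0 y) 0) +
          Real.cos β * Kerr.nullSpatial a (E4.ofTimeSpace 0 y) 1,
        Kerr.nullSpatial a (E4.ofTimeSpace 0 y) 2] : E3)‖ ^ 2 = ‖Kerr.nullSpatial a (E4.ofTimeSpace 0 y)‖ ^ 2 := by
    rw [E3.norm_sq, E3.norm_sq]
    simp only [Matrix.cons_val_zero, Matrix.cons_val_one, Matrix.cons_val]
    linear_combination (Kerr.nullSpatial a (E4.ofTimeSpace 0 y) 0 ^ 2 +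
      Kerr.nullSpatial a (E4.ofTimeSpace 0 y) 1 ^ 2) * hcs
  rw [h1] at hsq
  nlinarith [norm_nonneg (!₂[Real.cos β * Kerr.nullSpatial a (E4.ofTimeSpace 0 y) 0 +
        Real.sin β * Kerr.nullSpatial a (E4.ofTimeSpace 0 y) 1,
        -(Real.sin β * Kerr.nullSpatial a (E4.ofTimeSpace 0 y) 0) +
          Real.cos β * Kerr.nullSpatial a (E4.ofTimeSpace 0 y) 1,
        Kerr.nullSpatial a (E4.ofTimeSpace 0 y) 2] : E3)]

section CapChart

variable {ϱ α ϱinv : ℝ → ℝ} {a : ℝ} {X φ : E3 → E3}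
  (hX : ∀ u : E3, X u =
    !₂[(ϱ ‖u‖ * (Real.cos (α ‖u‖) * u 0 - Real.sin (α ‖u‖) * u 1) -
          a * (Real.sin (α ‖u‖) * u 0 + Real.cos (α ‖u‖) * u 1)) / ‖u‖,
       (ϱ ‖u‖ * (Real.sin (α ‖u‖) * u 0 + Real.cos (α ‖u‖) * u 1) +
          a * (Real.cos (α ‖u‖) * u 0 - Real.sin (α ‖u‖) * u 1)) / ‖u‖,
       ϱ ‖u‖ * u 2 / ‖u‖])
  (hφ : ∀ y : E3, φ y = ϱinv (Kerr.radius a (E4.ofTimeSpace 0 y)) •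
    !₂[Real.cos (α (ϱinv (Kerr.radius a (E4.ofTimeSpace 0 y)))) * Kerr.nullSpatial a (E4.ofTimeSpace 0 y) 0 +
          Real.sin (α (ϱinv (Kerr.radius a (E4.ofTimeSpace 0 y)))) * Kerr.nullSpatial a (E4.ofTimeSpace 0 y) 1,
       -(Real.sin (α (ϱinv (Kerr.radius a (E4.ofTimeSpace 0 y)))) * Kerr.nullSpatial a (E4.ofTimeSpace 0 y) 0) +
          Real.cos (α (ϱinv (Kerr.radius a (E4.ofTimeSpace 0 y)))) * Kerr.nullSpatial a (E4.ofTimeSpace 0 y) 1,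
       Kerr.nullSpatial a (E4.ofTimeSpace 0 y) 2])

/-! ### The end chart: norm, `X ∘ φ = id` -/

section Chart

include hφ

/-- **`‖φ x⃗‖ = ϱ⁻¹(r)`** (`ϱ⁻¹(r) ≥ 0`, `r > 0`): `ℓ⃗` is a unit vector and `Rot_z` an isometry. [folklore] -/
theorem norm_capChart {y : E3} (hr : 0 < Kerr.radius a (E4.ofTimeSpace 0 y))
    (hs : 0 ≤ ϱinv (Kerr.radius a (E4.ofTimeSpace 0 y))) : ‖φ y‖ = ϱinv (Kerr.radius a (E4.ofTimeSpace 0 y)) := by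
  rw [hφ y, norm_smul, norm_rotNullSpatial hr, mul_one, Real.norm_eq_abs, abs_of_nonneg hs]

/-- Components of the end chart. [folklore] -/
theorem capChart_apply (y : E3) :
    φ y 0 = ϱinv (Kerr.radius a (E4.ofTimeSpace 0 y)) *
        (Real.cos (α (ϱinv (Kerr.radius a (E4.ofTimeSpace 0 y)))) * Kerr.nullSpatial a (E4.ofTimeSpace 0 y) 0 +
          Real.sin (α (ϱinv (Kerr.radius a (E4.ofTimeSpace 0 y)))) * Kerr.nullSpatial a (E4.ofTimeSpace 0 y) 1) ∧
      φ y 1 = ϱinv (Kerr.radius a (E4.ofTimeSpace 0 y)) *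
        (-(Real.sin (α (ϱinv (Kerr.radius a (E4.ofTimeSpace 0 y)))) * Kerr.nullSpatial a (E4.ofTimeSpace 0 y) 0) +
          Real.cos (α (ϱinv (Kerr.radius a (E4.ofTimeSpace 0 y)))) * Kerr.nullSpatial a (E4.ofTimeSpace 0 y) 1) ∧
      φ y 2 = ϱinv (Kerr.radius a (E4.ofTimeSpace 0 y)) * Kerr.nullSpatial a (E4.ofTimeSpace 0 y) 2 := by
  rw [hφ y]
  exact ⟨rfl, rfl, rfl⟩

include hX

/-- **`X (φ x⃗) = x⃗`** wherever `r = r(0, x⃗) > 0`, `s := ϱ⁻¹(r) > 0` and `ϱ(s) = r`: `‖φ x⃗‖ = s`, so the cap map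
reads `φ x⃗ = s · Rot_z(−α(s)) ℓ⃗` with the profiles evaluated at `s`, `Rot_z(α(s)) Rot_z(−α(s)) = 1`, and
`L_r ℓ⃗(x⃗) = x⃗` (`spheroidal_nullSpatial`). Visser arXiv:0706.0622, §4. [cite: arXiv07060622, §4] -/
theorem capMap_capChart {y : E3} (hr : 0 < Kerr.radius a (E4.ofTimeSpace 0 y))
    (hs : 0 < ϱinv (Kerr.radius a (E4.ofTimeSpace 0 y)))
    (hϱs : ϱ (ϱinv (Kerr.radius a (E4.ofTimeSpace 0 y))) = Kerr.radius a (E4.ofTimeSpace 0 y)) : X (φ y) = y := by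
  have hnorm := norm_capChart hφ hr hs.le
  obtain ⟨hu0, hu1, hu2⟩ := capChart_apply hφ y
  obtain ⟨hL0, hL1, hL2⟩ := spheroidal_nullSpatial hr
  set r := Kerr.radius a (E4.ofTimeSpace 0 y) with hrdef
  set s := ϱinv r with hsdef
  set ℓ := Kerr.nullSpatial a (E4.ofTimeSpace 0 y) with hℓ
  have hcs := Real.sin_sq_add_cos_sq (α s)
  have hP : Real.cos (α s) * φ y 0 - Real.sin (α s) * φ y 1 = s * ℓ 0 := by
    rw [hu0, hu1]; linear_combination s * ℓ 0 * hcs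
  have hQ : Real.sin (α s) * φ y 0 + Real.cos (α s) * φ y 1 = s * ℓ 1 := by
    rw [hu0, hu1]; linear_combination s * ℓ 1 * hcs
  have hs0 : s ≠ 0 := hs.ne'
  rw [hX (φ y), hnorm, hP, hQ, hu2, hϱs]
  ext i
  fin_cases i
  · simp only [Fin.zero_eta, Fin.isValue, Matrix.cons_val_zero]
    rw [← hL0]; field_simp
  · simp only [Fin.mk_one, Fin.isValue, Matrix.cons_val_one, Matrix.cons_val_zero]
    rw [← hL1]; field_simp
  · simp only [Fin.reduceFinMk, Fin.isValue, Matrix.cons_val]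
    rw [← hL2]; field_simp

end Chart

/-! ### `φ ∘ X = id` -/

section Inverse

include hX

/-- **`ℓ⃗(X u) = Rot_z(α(s)) (u/s)`** (`u ≠ 0`, `ϱ(s) > 0`): with `X u = L_{ϱ(s)} n`, `n = Rot_z(α(s))(u/s)`, and
`r(X u) = ϱ(s)` (`radius_capMap`), `ℓ⃗(L_r n) = n` componentwise (`r(rP − aQ) + a(rQ + aP) = (r² + a²)P`, …).
Visser arXiv:0706.0622, §4 and (34). [cite: arXiv07060622, §4 and (34)] -/
theorem nullSpatial_capMap {u : E3} (hu : u ≠ 0) (hϱu : 0 < ϱ ‖u‖) :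
    Kerr.nullSpatial a (E4.ofTimeSpace 0 (X u)) =
      !₂[(Real.cos (α ‖u‖) * u 0 - Real.sin (α ‖u‖) * u 1) / ‖u‖,
         (Real.sin (α ‖u‖) * u 0 + Real.cos (α ‖u‖) * u 1) / ‖u‖, u 2 / ‖u‖] := by
  have hs0 : ‖u‖ ≠ 0 := norm_ne_zero_iff.2 hu
  have hrad : Kerr.radius a (E4.ofTimeSpace 0 (X u)) = ϱ ‖u‖ := radius_capMap hX hu hϱu 0
  obtain ⟨h0, h1, h2⟩ := nullSpatial_slice_apply a (X u)
  rw [hrad] at h0 h1 h2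
  have hra : ϱ ‖u‖ ^ 2 + a ^ 2 ≠ 0 := by positivity
  have hx0 := capMap_apply_zero hX u
  have hx1 := capMap_apply_one hX u
  have hx2 := capMap_apply_two hX u
  ext i
  fin_cases i
  · simp only [Fin.zero_eta, Fin.isValue, Matrix.cons_val_zero]
    rw [h0, hx0, hx1]; field_simp; ring
  · simp only [Fin.mk_one, Fin.isValue, Matrix.cons_val_one, Matrix.cons_val_zero]
    rw [h1, hx0, hx1]; field_simp; ring
  · simp only [Fin.reduceFinMk, Fin.isValue, Matrix.cons_val]
    rw [h2, hx2]; field_simp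

include hφ

/-- **`φ (X u) = u`** (`u ≠ 0`, `ϱ(s) > 0`, `ϱ⁻¹(ϱ(s)) = s`): `r(X u) = ϱ(s)`, so `ϱ⁻¹(r) = s`, and
`s · Rot_z(−α(s)) ℓ⃗(X u) = s · Rot_z(−α(s)) Rot_z(α(s)) (u/s) = u`. [cite: arXiv07060622, §4] -/
theorem capChart_capMap {u : E3} (hu : u ≠ 0) (hϱu : 0 < ϱ ‖u‖) (hinv : ϱinv (ϱ ‖u‖) = ‖u‖) : φ (X u) = u := by
  have hs0 : ‖u‖ ≠ 0 := norm_ne_zero_iff.2 hu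
  have hrad : Kerr.radius a (E4.ofTimeSpace 0 (X u)) = ϱ ‖u‖ := radius_capMap hX hu hϱu 0
  have hcs := Real.sin_sq_add_cos_sq (α ‖u‖)
  rw [hφ (X u), nullSpatial_capMap hX hu hϱu, hrad, hinv]
  ext i
  fin_cases i
  · simp only [PiLp.smul_apply, smul_eq_mul, Fin.zero_eta, Fin.isValue, Matrix.cons_val_zero,
      Matrix.cons_val_one]
    field_simp
    linear_combination u 0 * hcs
  · simp only [PiLp.smul_apply, smul_eq_mul, Fin.mk_one, Fin.isValue, Matrix.cons_val_one,
      Matrix.cons_val_zero]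
    field_simp
    linear_combination u 1 * hcs
  · simp only [PiLp.smul_apply, smul_eq_mul, Fin.reduceFinMk, Fin.isValue, Matrix.cons_val]
    field_simp

end Inverse

/-! ### Smoothness of the end chart -/

section Smooth

include hφ

/-- **The end chart is `C^∞` at every point with `r > 0` at which `ϱ⁻¹` is `C^∞`** (the radius is smooth where
positive, `Kerr.contDiffAt_radius_slice`; `ℓ⃗` is smooth there, `Kerr.contDiffAt_nullVector`; `α, cos, sin` are
smooth). [folklore] -/
theorem contDiffAt_capChart (hα : ContDiff ℝ ∞ α) {y : E3} (hr : 0 < Kerr.radius a (E4.ofTimeSpace 0 y))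
    (hϱinv : ContDiffAt ℝ ∞ ϱinv (Kerr.radius a (E4.ofTimeSpace 0 y))) : ContDiffAt ℝ ∞ φ y := by
  have hφf : φ = fun y ↦ ϱinv (Kerr.radius a (E4.ofTimeSpace 0 y)) •
      !₂[Real.cos (α (ϱinv (Kerr.radius a (E4.ofTimeSpace 0 y)))) * Kerr.nullSpatial a (E4.ofTimeSpace 0 y) 0 +
            Real.sin (α (ϱinv (Kerr.radius a (E4.ofTimeSpace 0 y)))) * Kerr.nullSpatial a (E4.ofTimeSpace 0 y) 1,
         -(Real.sin (α (ϱinv (Kerr.radius a (E4.ofTimeSpace 0 y)))) * Kerr.nullSpatial a (E4.ofTimeSpace 0 y) 0) +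
            Real.cos (α (ϱinv (Kerr.radius a (E4.ofTimeSpace 0 y)))) * Kerr.nullSpatial a (E4.ofTimeSpace 0 y) 1,
         Kerr.nullSpatial a (E4.ofTimeSpace 0 y) 2] := funext hφ
  have hR : ContDiffAt ℝ ∞ (fun y : E3 ↦ Kerr.radius a (E4.ofTimeSpace 0 y)) y := Kerr.contDiffAt_radius_slice hr
  have hS : ContDiffAt ℝ ∞ (fun y : E3 ↦ ϱinv (Kerr.radius a (E4.ofTimeSpace 0 y))) y := hϱinv.comp y hR
  have hB : ContDiffAt ℝ ∞ (fun y : E3 ↦ α (ϱinv (Kerr.radius a (E4.ofTimeSpace 0 y)))) y :=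
    hα.contDiffAt.comp y hS
  have hc : ContDiffAt ℝ ∞ (fun y : E3 ↦ Real.cos (α (ϱinv (Kerr.radius a (E4.ofTimeSpace 0 y))))) y :=
    Real.contDiff_cos.contDiffAt.comp y hB
  have hs : ContDiffAt ℝ ∞ (fun y : E3 ↦ Real.sin (α (ϱinv (Kerr.radius a (E4.ofTimeSpace 0 y))))) y :=
    Real.contDiff_sin.contDiffAt.comp y hB
  have hL : ContDiffAt ℝ ∞ (fun y : E3 ↦ Kerr.nullSpatial a (E4.ofTimeSpace 0 y)) y := by
    have h1 : ContDiffAt ℝ ∞ (fun y : E3 ↦ Kerr.nullVector a (E4.ofTimeSpace 0 y)) y :=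
      (Kerr.contDiffAt_nullVector a hr).comp y (E4.contDiff_ofTimeSpace 0).contDiffAt
    exact E4.spatial.contDiff.contDiffAt.comp y h1
  have hLi : ∀ i : Fin 3, ContDiffAt ℝ ∞ (fun y : E3 ↦ Kerr.nullSpatial a (E4.ofTimeSpace 0 y) i) y := fun i ↦
    (contDiffAt_piLp_apply (𝕜 := ℝ) (p := 2) (i := i)).comp y hL
  have hV : ContDiffAt ℝ ∞ (fun y : E3 ↦
      (!₂[Real.cos (α (ϱinv (Kerr.radius a (E4.ofTimeSpace 0 y)))) * Kerr.nullSpatial a (E4.ofTimeSpace 0 y) 0 +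
            Real.sin (α (ϱinv (Kerr.radius a (E4.ofTimeSpace 0 y)))) * Kerr.nullSpatial a (E4.ofTimeSpace 0 y) 1,
         -(Real.sin (α (ϱinv (Kerr.radius a (E4.ofTimeSpace 0 y)))) * Kerr.nullSpatial a (E4.ofTimeSpace 0 y) 0) +
            Real.cos (α (ϱinv (Kerr.radius a (E4.ofTimeSpace 0 y)))) * Kerr.nullSpatial a (E4.ofTimeSpace 0 y) 1,
         Kerr.nullSpatial a (E4.ofTimeSpace 0 y) 2] : E3)) y := by
    rw [contDiffAt_euclidean]
    intro i
    fin_cases i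
    · exact (hc.mul (hLi 0)).add (hs.mul (hLi 1))
    · exact (hs.mul (hLi 0)).neg.add (hc.mul (hLi 1))
    · exact hLi 2
  rw [hφf]
  exact hS.smul hV

/-- The end chart is continuous at every point with `r > 0` at which `ϱ⁻¹` is `C^∞`. [folklore] -/
theorem continuousAt_capChart (hα : ContDiff ℝ ∞ α) {y : E3} (hr : 0 < Kerr.radius a (E4.ofTimeSpace 0 y))
    (hϱinv : ContDiffAt ℝ ∞ ϱinv (Kerr.radius a (E4.ofTimeSpace 0 y))) : ContinuousAt φ y :=
  (contDiffAt_capChart hφ hα hr hϱinv).continuousAt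

end Smooth

/-! ### The end chart on the Kerr–Schild slice `{r > r_b}`: range, open embedding, smoothness -/

section Topology

include hX hφ

/-- **The end chart on the slice `{r > r_b}`** (`0 ≤ r_b`, `0 ≤ σ₄`; `ϱ⁻¹ ∘ ϱ = id` on `{s > σ₄}` with
`ϱ > r_b` there, `ϱ ∘ ϱ⁻¹ = id` on `{r > r_b}` with `ϱ⁻¹ > σ₄` there; `ϱ, α` smooth, `ϱ⁻¹` smooth on `(r_b, ∞)`):
its restriction to `Kerr.slice a r_b` has range `{u | σ₄ < ‖u‖}`, is an open embedding (a homeomorphism onto this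
open set, with continuous inverse `X`, followed by the inclusion) and is `C^∞` as a map of manifolds
`Kerr.slice a r_b → E3`. O'Neill 1983, Ch. 1, pp. 4–5 and 18–19. [cite: ONeill1983, Ch. 1] -/
theorem capChart_topology {rb σ₄ : ℝ} (hrb : 0 ≤ rb) (hσ₄ : 0 ≤ σ₄) (hϱc : ContDiff ℝ ∞ ϱ) (hα : ContDiff ℝ ∞ α)
    (hinv1 : ∀ s, σ₄ < s → rb < ϱ s ∧ ϱinv (ϱ s) = s) (hinv2 : ∀ r, rb < r → σ₄ < ϱinv r ∧ ϱ (ϱinv r) = r)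
    (hϱinv : ContDiffOn ℝ ∞ ϱinv (Set.Ioi rb)) :
    Set.range (fun y : Kerr.slice a rb ↦ φ y) = {u : E3 | σ₄ < ‖u‖} ∧
      Topology.IsOpenEmbedding (fun y : Kerr.slice a rb ↦ φ y) ∧
      ContMDiff 𝓘(ℝ, E3) (𝓡 3) ∞ (fun y : Kerr.slice a rb ↦ φ y) := by
  -- pointwise facts on the slice
  have hmem : ∀ {y : E3}, y ∈ Kerr.slice a rb ↔ rb < Kerr.radius a (E4.ofTimeSpace 0 y) := fun {y} ↦ by
    rw [Kerr.mem_slice, max_eq_left hrb]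
  have hrpos : ∀ {y : E3}, y ∈ Kerr.slice a rb → 0 < Kerr.radius a (E4.ofTimeSpace 0 y) := fun hy ↦
    hrb.trans_lt (hmem.1 hy)
  have hspos : ∀ {y : E3}, y ∈ Kerr.slice a rb → 0 < ϱinv (Kerr.radius a (E4.ofTimeSpace 0 y)) := fun hy ↦
    hσ₄.trans_lt (hinv2 _ (hmem.1 hy)).1
  have hnorm : ∀ {y : E3}, y ∈ Kerr.slice a rb → ‖φ y‖ = ϱinv (Kerr.radius a (E4.ofTimeSpace 0 y)) := fun hy ↦
    norm_capChart hφ (hrpos hy) (hspos hy).le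
  have hφmem : ∀ {y : E3}, y ∈ Kerr.slice a rb → σ₄ < ‖φ y‖ := fun hy ↦ by
    rw [hnorm hy]; exact (hinv2 _ (hmem.1 hy)).1
  have hne : ∀ {u : E3}, σ₄ < ‖u‖ → u ≠ 0 := fun hu h0 ↦ by
    rw [h0, norm_zero] at hu; linarith
  have hϱu : ∀ {u : E3}, σ₄ < ‖u‖ → 0 < ϱ ‖u‖ := fun hu ↦ hrb.trans_lt (hinv1 _ hu).1
  have hXmem : ∀ {u : E3}, σ₄ < ‖u‖ → X u ∈ Kerr.slice a rb := fun hu ↦ by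
    rw [hmem, radius_capMap hX (hne hu) (hϱu hu) 0]; exact (hinv1 _ hu).1
  have hXφ : ∀ {y : E3}, y ∈ Kerr.slice a rb → X (φ y) = y := fun hy ↦
    capMap_capChart hX hφ (hrpos hy) (hspos hy) (hinv2 _ (hmem.1 hy)).2
  have hφX : ∀ {u : E3}, σ₄ < ‖u‖ → φ (X u) = u := fun hu ↦
    capChart_capMap hX hφ (hne hu) (hϱu hu) (hinv1 _ hu).2
  have hφc : ∀ {y : E3}, y ∈ Kerr.slice a rb → ContDiffAt ℝ ∞ φ y := fun hy ↦
    contDiffAt_capChart hφ hα (hrpos hy) (hϱinv.contDiffAt (Ioi_mem_nhds (hmem.1 hy)))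
  -- the homeomorphism onto `{‖u‖ > σ₄}`
  set Ω₄ : Opens E3 := ⟨{u : E3 | σ₄ < ‖u‖}, isOpen_lt continuous_const continuous_norm⟩ with hΩ₄
  have hcφ : Continuous fun y : Kerr.slice a rb ↦ (⟨φ y, hφmem y.2⟩ : Ω₄) :=
    (continuousOn_iff_continuous_restrict.1 fun y hy ↦ (hφc hy).continuousAt.continuousWithinAt).subtype_mk _
  have hcX : Continuous fun u : Ω₄ ↦ (⟨X u, hXmem u.2⟩ : Kerr.slice a rb) :=
    (continuousOn_iff_continuous_restrict.1 fun u hu ↦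
      (contDiffAt_capMap hX hϱc hα (hne hu)).continuousAt.continuousWithinAt).subtype_mk _
  let H : Kerr.slice a rb ≃ₜ Ω₄ :=
    { toFun := fun y ↦ ⟨φ y, hφmem y.2⟩, invFun := fun u ↦ ⟨X u, hXmem u.2⟩,
      left_inv := fun y ↦ Subtype.ext (hXφ y.2), right_inv := fun u ↦ Subtype.ext (hφX u.2),
      continuous_toFun := hcφ, continuous_invFun := hcX }
  have hcomp : (fun y : Kerr.slice a rb ↦ φ y) = Subtype.val ∘ H := rfl
  refine ⟨?_, ?_, ?_⟩
  · rw [hcomp, H.surjective.range_comp]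
    exact Subtype.range_coe
  · rw [hcomp]
    exact Ω₄.isOpen.isOpenEmbedding_subtypeVal.comp H.isOpenEmbedding
  · intro y
    exact (OpensChart.contMDiffAt_iff y (fun y : Kerr.slice a rb ↦ φ y) φ (fun _ ↦ rfl)).2 (hφc y.2)

end Topology

end CapChart

end KerrCap

/-- **Registered export of this file** (sub-goal `cap_chart` of stub `stub_capShield`): the end chart
`φ = ϱ⁻¹(r) · Rot_z(−α(ϱ⁻¹ r)) ℓ⃗` on the slice `{r > r_b}` has range `{‖u‖ > σ₄}`, is an open embedding and is
`C^∞`, `KerrCap.capChart_topology`. [cite: arXiv07060622, §4] -/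
theorem cap_chart :
    ∀ {ϱ α ϱinv : ℝ → ℝ} {a rb σ₄ : ℝ} {X φ : E3 → E3}, (∀ u : E3, X u = !₂[(ϱ ‖u‖ * (Real.cos (α ‖u‖) * u 0 - Real.sin (α ‖u‖) * u 1) - a * (Real.sin (α ‖u‖) * u 0 + Real.cos (α ‖u‖) * u 1)) / ‖u‖, (ϱ ‖u‖ * (Real.sin (α ‖u‖) * u 0 + Real.cos (α ‖u‖) * u 1) + a * (Real.cos (α ‖u‖) * u 0 - Real.sin (α ‖u‖) * u 1)) / ‖u‖, ϱ ‖u‖ * u 2 / ‖u‖]) → (∀ y : E3, φ y = ϱinv (Kerr.radius a (E4.ofTimeSpace 0 y)) • !₂[Real.cos (α (ϱinv (Kerr.radius a (E4.ofTimeSpace 0 y)))) * Kerr.nullSpatial a (E4.ofTimeSpace 0 y) 0 + Real.sin (α (ϱinv (Kerr.radius a (E4.ofTimeSpace 0 y)))) * Kerr.nullSpatial a (E4.ofTimeSpace 0 y) 1, -(Real.sin (α (ϱinv (Kerr.radius a (E4.ofTimeSpace 0 y)))) * Kerr.nullSpatial a (E4.ofTimeSpace 0 y) 0) + Real.cos (α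 (ϱinv (Kerr.radius a (E4.ofTimeSpace 0 y)))) * Kerr.nullSpatial a (E4.ofTimeSpace 0 y) 1, Kerr.nullSpatial a (E4.ofTimeSpace 0 y) 2]) → 0 ≤ rb → 0 ≤ σ₄ → ContDiff ℝ ∞ ϱ → ContDiff ℝ ∞ α → (∀ s, σ₄ < s → rb < ϱ s ∧ ϱinv (ϱ s) = s) → (∀ r, rb < r → σ₄ < ϱinv r ∧ ϱ (ϱinv r) = r) → ContDiffOn ℝ ∞ ϱinv (Set.Ioi rb) → Set.range (fun y : Kerr.slice a rb ↦ φ y) = {u : E3 | σ₄ < ‖u‖} ∧ Topology.IsOpenEmbedding (fun y : Kerr.slice a rb ↦ φ y) ∧ ContMDiff 𝓘(ℝ, E3) (𝓡 3) ∞ (fun y : Kerr.slice a rb ↦ φ y) :=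
  fun hX hφ hrb hσ₄ hϱc hα hinv1 hinv2 hϱinv ↦ KerrCap.capChart_topology hX hφ hrb hσ₄ hϱc hα hinv1 hinv2 hϱinv

end Summit.FinalStateConjecture.FinalStateConjecture.Theorems.SwallowTheDatum

end
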